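import Summits.HodgeConjecture.HodgeConjecture.Theorems.R90S6HSideEllipticValue                -- ★ H2 (this seat): the generic junction `orbitalIntegral_coeff_toVector_eq_mul_sum_ncard_shell` &c.; brings ★ A1, ★ (J1)
import Literature.NumberTheory.Automorphic.HyperspecialUnitarySatakeIsomorphismAdicCompletion    -- ★ `isHeckeTriple_unitaryInt_adicCompletion`; brings the adic datum `unramifiedLocalConjDatum_localConjUniformizer`
import HarnessLib

/-!
# R90 · S6 — CARD G3 (rows E1.3.5.2.1 «unfolding at displacement m» ∕ E1.4.4.2.3 ∕ E1.3.5.2.6, G side): ORBITAL INTEGRALS OF A HECKE COMBINATION ON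
# `U(2,1)_w` AS DISPLACEMENT COUNTS ON THE HYPERSPECIAL TREE (`Theorems/R90S6GSideEllipticValue.lean`)

Cell `hodgecm-mathlib`, crux H413 (`stmt-HodgeConjecture-24833`), route of record `HCCMUnconditional`; programme R90-TF, section S6 (base `R90-C14`), seat
R90-C14-p03 (g2); card G3 (dealer R90-C14-plan (g2), R90 bus 2026-09-05T01:46:47Z).  Helper lane `--supports stmt-HodgeConjecture-24833 --as helper`; THEOREMS ONLY
(no definition, no instance, no notation, no named fact, no `sorry`); imports ★ H2 `R90S6HSideEllipticValue` (generic junction §1; brings ★ A1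
`R90S6EllipticOrbitalDisplacementCount` and ★ (J1)) + ★ `HyperspecialUnitarySatakeIsomorphismAdicCompletion` (adic Hecke pair and datum) + HarnessLib.

THE MATHEMATICS — the `N = 3` twin of ★ H2 §2.  For `f = Σ_{k ∈ s} c_k Φ_k ∈ ℋ(U(J₀,3)(K), K₀)` (`Φ_k = T_{K₀ tᵏ K₀} = doubleCosetOperator K₀ (hd.torusGen ^ k)`, an
ABSTRACT finite expansion hypothesis — e.g. `f = ψ̂_G φ` of W10-g∕h, or `f = ξ`-side images) and `γ ∈ U(J₀,3)(K)` with COMPACT centraliser (Haar measure `t` of mass one),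
`ν` Haar with `ν(K₀) < ∞`, and finitely many hyperspecial (self-dual) vertices displaced by `2k` for each `k ∈ s`:
**`O_γ^{ν∕t}(g ↦ (f [K₀])(gK₀)) = ν(K₀) · Σ_{k ∈ s} c_k · #{x ∈ X₃ : x self-dual ∧ d(x, γ·x) = 2k}`** — ★ H2's generic `orbitalIntegral_coeff_toVector_eq_mul_sum_ncard_shell`
road, summand by summand over ★ A1 `orbitalIntegral_doubleCosetShell_eq_mul_ncard_displaced` (shell `K₀ tᵏ K₀` ↔ displacement `2k`: ★ (J2) `ncard_quotient_shell_eq_ncard_selfDual_displaced`,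
finiteness ★ `finite_quotient_shell_of_finite_displaced`): §1 `orbitalIntegral_coeff_toVector_eq_mul_sum_ncard_displaced_three` (any `s`), `…_range_…` (`s = {0,…,m}`), the
ONE-SHELL case `orbitalIntegral_coeff_toVector_doubleCosetOperator_torusGen_pow` (`f = Φ_m`, no `ν(K₀) < ∞` needed), and §2 the inert-place edition at `E_w` (`K₀` compact ★
`isCompact_unitaryInt_adicCompletion`, Hecke pair ★ `isHeckeTriple_unitaryInt_adicCompletion`).
HONEST LABEL: measure ∕ Hecke bookkeeping over ★ carriers; the topological, Borel and Haar structures on `U(J₀,3)` are BINDERS (as in ★ A1); proves no printed global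
statement, discharges no citation; count-neutral helper until E1.3.5.2.1∕.6 and E1.4.4.2.3 consume it.
HC_CM is proved only modulo the 7 printed citations (2 remaining named inputs: hLiu418 = stmt-HodgeConjecture-24832, h413 = stmt-HodgeConjecture-24833) until rung 0 closes; REL ≠ ★ ≠ BUILT.

## References
* [Rogawski1990] J. D. Rogawski, *Automorphic Representations of Unitary Groups in Three Variables*, Ann. of Math. Stud. 123 (1990): §4.9 pp. 54–56, §4.11 pp. 59–60.
* [Kottwitz1986BaseChangeUnits] R. E. Kottwitz, *Base change for unit elements of Hecke algebras*, Compositio Math. 60 (1986): §1 pp. 240–242, §3.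
* [Laumon1995] G. Laumon, *Cohomology of Drinfeld Modular Varieties*, Part I (1996): Lemma (5.3.2) p. 136.
* [BruhatTits1972] F. Bruhat, J. Tits, *Groupes réductifs sur un corps local I*, Publ. Math. IHÉS 41 (1972): §10.
-/

set_option autoImplicit false
-- the mandated namespace repeats the single-problem summit's segment (`HodgeConjecture.HodgeConjecture`)
set_option linter.dupNamespace false

noncomputable section

open MeasureTheory Measure Topology Set Function
open scoped ENNReal NNReal Pointwise Valued WithZero Matrix MatrixGroups
open MulAction SimpleGraph
open Literature.MeasureTheory.Group Literature.NumberTheory.Automorphic Literature.NumberTheory.Automorphic.heckeAlgebra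
open Literature.NumberTheory.Automorphic.HermitianLattice Literature.NumberTheory.Automorphic.UnitaryLatticeTree
open Literature.Combinatorics.SimpleGraph

namespace Summit.HodgeConjecture.HodgeConjecture.R90.S6

/-! ## §1 `U(2,1)`: the orbital integral of the function of `Σ_k c_k Φ_k` as a combination of displacement counts on the hyperspecial tree -/

section Unitary

variable {K : Type*} [Field K] [Valued K ℤᵐ⁰] {σ : K →+* K} {ϖ : K}
  (hd : UnramifiedLocalConjDatum σ ϖ)
  [IsHeckeTriple (⊤ : Submonoid (unitaryGroupOfForm σ ((StdForm.antidiagonal 3).over K)))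
    (unitaryInt σ ((StdForm.antidiagonal 3).over K)) (unitaryInt σ ((StdForm.antidiagonal 3).over K))]
  [LocallyCompactSpace (unitaryGroupOfForm σ ((StdForm.antidiagonal 3).over K))]
  [SecondCountableTopology (unitaryGroupOfForm σ ((StdForm.antidiagonal 3).over K))]
  [MeasurableSpace (unitaryGroupOfForm σ ((StdForm.antidiagonal 3).over K))] [BorelSpace (unitaryGroupOfForm σ ((StdForm.antidiagonal 3).over K))]
  (γ : unitaryGroupOfForm σ ((StdForm.antidiagonal 3).over K))
  [MeasurableSpace (unitaryGroupOfForm σ ((StdForm.antidiagonal 3).over K) ⧸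
    Subgroup.centralizer ({γ} : Set (unitaryGroupOfForm σ ((StdForm.antidiagonal 3).over K))))]
  [BorelSpace (unitaryGroupOfForm σ ((StdForm.antidiagonal 3).over K) ⧸
    Subgroup.centralizer ({γ} : Set (unitaryGroupOfForm σ ((StdForm.antidiagonal 3).over K))))]
  [hC : IsClosed ((Subgroup.centralizer ({γ} : Set (unitaryGroupOfForm σ ((StdForm.antidiagonal 3).over K))) :
    Subgroup (unitaryGroupOfForm σ ((StdForm.antidiagonal 3).over K))) : Set (unitaryGroupOfForm σ ((StdForm.antidiagonal 3).over K)))]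
  (t : Measure (Subgroup.centralizer ({γ} : Set (unitaryGroupOfForm σ ((StdForm.antidiagonal 3).over K)))))
  [t.IsMulLeftInvariant] [IsFiniteMeasureOnCompacts t] [t.IsOpenPosMeasure] [t.IsInvInvariant] [SFinite t]
  (ν : Measure (unitaryGroupOfForm σ ((StdForm.antidiagonal 3).over K))) [IsHaarMeasure ν] [ν.IsMulRightInvariant]
  [CompactSpace (Subgroup.centralizer ({γ} : Set (unitaryGroupOfForm σ ((StdForm.antidiagonal 3).over K))))]
  (ht : t Set.univ = 1)
include ht

/-- **`U(2,1)` — THE ORBITAL INTEGRAL OF THE FUNCTION OF `f = Σ_{k ∈ s} c_k Φ_k` IS `ν(K₀) · Σ_k c_k · #{x self-dual : d(x, γ·x) = 2k}`** (`Φ_k = T_{K₀ tᵏ K₀}`, `t = hd.torusGen`;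
ABSTRACT finite expansion hypothesis `hf`; `γ` with COMPACT centraliser, mass-one `t`; `ν` Haar with `ν(K₀) < ∞`; finitely many hyperspecial vertices displaced by each `2k`, `k ∈ s`):
★ H2's generic junction (`coeff_toVector_sum_smul`, `coeff_toVector_doubleCosetOperator_eq_indicator`, `orbitalIntegral_finset_sum_smul`, `integrable_descConj_indicator_shell`,
`orbitalIntegral_indicator_complex_eq_ofReal`) summand by summand over ★ A1 `orbitalIntegral_doubleCosetShell_eq_mul_ncard_displaced` and its finiteness transfer
★ `finite_quotient_shell_of_finite_displaced`. [cite: Rogawski1990, §4.9 pp. 54–55] [cite: Kottwitz1986BaseChangeUnits, §1 pp. 240–242] [cite: Laumon1995, Lemma (5.3.2) p. 136] -/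
theorem orbitalIntegral_coeff_toVector_eq_mul_sum_ncard_displaced_three (hνK : ν (unitaryInt σ ((StdForm.antidiagonal 3).over K)) ≠ ∞)
    (s : Finset ℕ) (c : ℕ → ℂ)
    (f : heckeAlgebra ℂ (unitaryGroupOfForm σ ((StdForm.antidiagonal 3).over K)) (unitaryInt σ ((StdForm.antidiagonal 3).over K)))
    (hf : f = ∑ k ∈ s, c k • doubleCosetOperator (unitaryInt σ ((StdForm.antidiagonal 3).over K)) (hd.torusGen ^ k))
    (hfin : ∀ k ∈ s, {x : {M : Submodule 𝒪[K] (Fin 3 → K) // IsVertex σ ϖ ((StdForm.antidiagonal 3).over K) M} |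
        IsSelfDualLattice σ ϖ ((StdForm.antidiagonal 3).over K) x.1 ∧
          (latticeGraph σ ϖ ((StdForm.antidiagonal 3).over K)).dist x (latticeGraphPerm σ ϖ ((StdForm.antidiagonal 3).over K) γ x) = 2 * k}.Finite) :
    orbitalIntegral γ (fun x : unitaryGroupOfForm σ ((StdForm.antidiagonal 3).over K) =>
        (toVector (unitaryInt σ ((StdForm.antidiagonal 3).over K)) f).coeff
          (x : unitaryGroupOfForm σ ((StdForm.antidiagonal 3).over K) ⧸ unitaryInt σ ((StdForm.antidiagonal 3).over K)))
        (quotientMeasure (Subgroup.centralizer ({γ} : Set (unitaryGroupOfForm σ ((StdForm.antidiagonal 3).over K)))) t hC ν) =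
      (ν (unitaryInt σ ((StdForm.antidiagonal 3).over K))).toReal *
        ∑ k ∈ s, c k *
          ({x : {M : Submodule 𝒪[K] (Fin 3 → K) // IsVertex σ ϖ ((StdForm.antidiagonal 3).over K) M} |
              IsSelfDualLattice σ ϖ ((StdForm.antidiagonal 3).over K) x.1 ∧
                (latticeGraph σ ϖ ((StdForm.antidiagonal 3).over K)).dist x
                  (latticeGraphPerm σ ϖ ((StdForm.antidiagonal 3).over K) γ x) = 2 * k}.ncard : ℂ) := by
  have hK₀ : IsOpen (unitaryInt σ ((StdForm.antidiagonal 3).over K) : Set (unitaryGroupOfForm σ ((StdForm.antidiagonal 3).over K))) :=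
    isOpen_unitaryInt σ _
  -- the function of `f` is `Σ_k c_k 1_{K₀ t^k K₀}`
  have hfun : (fun x : unitaryGroupOfForm σ ((StdForm.antidiagonal 3).over K) =>
      (toVector (unitaryInt σ ((StdForm.antidiagonal 3).over K)) f).coeff
        (x : unitaryGroupOfForm σ ((StdForm.antidiagonal 3).over K) ⧸ unitaryInt σ ((StdForm.antidiagonal 3).over K))) =
      ∑ k ∈ s, c k • (DoubleCoset.doubleCoset (hd.torusGen ^ k)
        (unitaryInt σ ((StdForm.antidiagonal 3).over K) : Set (unitaryGroupOfForm σ ((StdForm.antidiagonal 3).over K)))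
        (unitaryInt σ ((StdForm.antidiagonal 3).over K))).indicator (1 : unitaryGroupOfForm σ ((StdForm.antidiagonal 3).over K) → ℂ) := by
    funext x
    rw [hf, coeff_toVector_sum_smul, Finset.sum_apply]
    refine Finset.sum_congr rfl fun i _ => ?_
    rw [Pi.smul_apply, smul_eq_mul, coeff_toVector_doubleCosetOperator_eq_indicator]
  -- each shell indicator is integrable (finite shell by ★ A1's transfer)
  have hint : ∀ k ∈ s, Integrable (descConj γ (Subgroup.centralizer ({γ} : Set (unitaryGroupOfForm σ ((StdForm.antidiagonal 3).over K))))
      (fun _ hg => Subgroup.mem_centralizer_singleton_iff.1 hg)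
      ((DoubleCoset.doubleCoset (hd.torusGen ^ k)
        (unitaryInt σ ((StdForm.antidiagonal 3).over K) : Set (unitaryGroupOfForm σ ((StdForm.antidiagonal 3).over K)))
        (unitaryInt σ ((StdForm.antidiagonal 3).over K))).indicator (1 : unitaryGroupOfForm σ ((StdForm.antidiagonal 3).over K) → ℂ)))
      (quotientMeasure (Subgroup.centralizer ({γ} : Set (unitaryGroupOfForm σ ((StdForm.antidiagonal 3).over K)))) t hC ν) := by
    intro k hk
    refine integrable_descConj_indicator_shell γ (unitaryInt σ ((StdForm.antidiagonal 3).over K)) t ν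
      (isOpen_doubleCoset _ (hd.torusGen ^ k) hK₀) (conj_mem_doubleCoset_iff _ (hd.torusGen ^ k)) hK₀ ht hνK ?_
    rw [setOf_out_conj_mem_doubleCoset_eq]
    exact finite_quotient_shell_of_finite_displaced hd γ k (hfin k hk)
  rw [hfun, orbitalIntegral_finset_sum_smul γ _ _ c _ hint, Finset.mul_sum]
  refine Finset.sum_congr rfl fun k hk => ?_
  rw [orbitalIntegral_indicator_complex_eq_ofReal, orbitalIntegral_doubleCosetShell_eq_mul_ncard_displaced hd γ t ν ht k (hfin k hk)]
  push_cast
  ring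

/-- **Range edition** (`s = {0, …, m}`, finiteness for each `k ≤ m`): `O_γ^{ν∕t}(g ↦ (f [K₀])(gK₀)) = ν(K₀) · Σ_{k ≤ m} c_k · #{x self-dual : d(x, γ·x) = 2k}` for
`f = Σ_{k ≤ m} c_k Φ_k` — the shape of the images `ψ̂_G(T)` ∕ triangular expansions (W10-g∕h) and of ★ H2 §2.
[cite: Rogawski1990, §4.9 pp. 54–55] [cite: Kottwitz1986BaseChangeUnits, §1 pp. 240–242] -/
theorem orbitalIntegral_coeff_toVector_eq_mul_sum_range_ncard_displaced_three (hνK : ν (unitaryInt σ ((StdForm.antidiagonal 3).over K)) ≠ ∞)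
    (m : ℕ) (c : ℕ → ℂ)
    (f : heckeAlgebra ℂ (unitaryGroupOfForm σ ((StdForm.antidiagonal 3).over K)) (unitaryInt σ ((StdForm.antidiagonal 3).over K)))
    (hf : f = ∑ k ∈ Finset.range (m + 1), c k • doubleCosetOperator (unitaryInt σ ((StdForm.antidiagonal 3).over K)) (hd.torusGen ^ k))
    (hfin : ∀ k ≤ m, {x : {M : Submodule 𝒪[K] (Fin 3 → K) // IsVertex σ ϖ ((StdForm.antidiagonal 3).over K) M} |
        IsSelfDualLattice σ ϖ ((StdForm.antidiagonal 3).over K) x.1 ∧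
          (latticeGraph σ ϖ ((StdForm.antidiagonal 3).over K)).dist x (latticeGraphPerm σ ϖ ((StdForm.antidiagonal 3).over K) γ x) = 2 * k}.Finite) :
    orbitalIntegral γ (fun x : unitaryGroupOfForm σ ((StdForm.antidiagonal 3).over K) =>
        (toVector (unitaryInt σ ((StdForm.antidiagonal 3).over K)) f).coeff
          (x : unitaryGroupOfForm σ ((StdForm.antidiagonal 3).over K) ⧸ unitaryInt σ ((StdForm.antidiagonal 3).over K)))
        (quotientMeasure (Subgroup.centralizer ({γ} : Set (unitaryGroupOfForm σ ((StdForm.antidiagonal 3).over K)))) t hC ν) =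
      (ν (unitaryInt σ ((StdForm.antidiagonal 3).over K))).toReal *
        ∑ k ∈ Finset.range (m + 1), c k *
          ({x : {M : Submodule 𝒪[K] (Fin 3 → K) // IsVertex σ ϖ ((StdForm.antidiagonal 3).over K) M} |
              IsSelfDualLattice σ ϖ ((StdForm.antidiagonal 3).over K) x.1 ∧
                (latticeGraph σ ϖ ((StdForm.antidiagonal 3).over K)).dist x
                  (latticeGraphPerm σ ϖ ((StdForm.antidiagonal 3).over K) γ x) = 2 * k}.ncard : ℂ) :=
  orbitalIntegral_coeff_toVector_eq_mul_sum_ncard_displaced_three hd γ t ν ht hνK (Finset.range (m + 1)) c f hf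
    (fun k hk => hfin k (Nat.lt_succ_iff.mp (Finset.mem_range.mp hk)))

/-- **One shell (row E1.3.5.2.1 «unfolding at displacement m»)**: the `ℂ`-valued orbital integral of the FUNCTION of `Φ_m = T_{K₀ tᵐ K₀}` is
`ν(K₀) · #{x self-dual : d(x, γ·x) = 2m}` (no `ν(K₀) < ∞` needed: ★ A1 `orbitalIntegral_doubleCosetShell_eq_mul_ncard_displaced` through the junction
`coeff_toVector_doubleCosetOperator_eq_indicator` and the `ℂ ∕ ℝ` bridge). [cite: Rogawski1990, §4.9 pp. 54–55] [cite: Kottwitz1986BaseChangeUnits, §1 pp. 240–242] -/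
theorem orbitalIntegral_coeff_toVector_doubleCosetOperator_torusGen_pow (m : ℕ)
    (hfin : {x : {M : Submodule 𝒪[K] (Fin 3 → K) // IsVertex σ ϖ ((StdForm.antidiagonal 3).over K) M} |
        IsSelfDualLattice σ ϖ ((StdForm.antidiagonal 3).over K) x.1 ∧
          (latticeGraph σ ϖ ((StdForm.antidiagonal 3).over K)).dist x (latticeGraphPerm σ ϖ ((StdForm.antidiagonal 3).over K) γ x) = 2 * m}.Finite) :
    orbitalIntegral γ (fun x : unitaryGroupOfForm σ ((StdForm.antidiagonal 3).over K) =>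
        (toVector (unitaryInt σ ((StdForm.antidiagonal 3).over K))
          (doubleCosetOperator (k := ℂ) (unitaryInt σ ((StdForm.antidiagonal 3).over K)) (hd.torusGen ^ m))).coeff
          (x : unitaryGroupOfForm σ ((StdForm.antidiagonal 3).over K) ⧸ unitaryInt σ ((StdForm.antidiagonal 3).over K)))
        (quotientMeasure (Subgroup.centralizer ({γ} : Set (unitaryGroupOfForm σ ((StdForm.antidiagonal 3).over K)))) t hC ν) =
      (ν (unitaryInt σ ((StdForm.antidiagonal 3).over K))).toReal *
        ({x : {M : Submodule 𝒪[K] (Fin 3 → K) // IsVertex σ ϖ ((StdForm.antidiagonal 3).over K) M} |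
            IsSelfDualLattice σ ϖ ((StdForm.antidiagonal 3).over K) x.1 ∧
              (latticeGraph σ ϖ ((StdForm.antidiagonal 3).over K)).dist x
                (latticeGraphPerm σ ϖ ((StdForm.antidiagonal 3).over K) γ x) = 2 * m}.ncard : ℂ) := by
  have hfun : (fun x : unitaryGroupOfForm σ ((StdForm.antidiagonal 3).over K) =>
      (toVector (unitaryInt σ ((StdForm.antidiagonal 3).over K))
        (doubleCosetOperator (k := ℂ) (unitaryInt σ ((StdForm.antidiagonal 3).over K)) (hd.torusGen ^ m))).coeff
        (x : unitaryGroupOfForm σ ((StdForm.antidiagonal 3).over K) ⧸ unitaryInt σ ((StdForm.antidiagonal 3).over K))) =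
      (DoubleCoset.doubleCoset (hd.torusGen ^ m)
        (unitaryInt σ ((StdForm.antidiagonal 3).over K) : Set (unitaryGroupOfForm σ ((StdForm.antidiagonal 3).over K)))
        (unitaryInt σ ((StdForm.antidiagonal 3).over K))).indicator (1 : unitaryGroupOfForm σ ((StdForm.antidiagonal 3).over K) → ℂ) := by
    funext x
    exact coeff_toVector_doubleCosetOperator_eq_indicator _ (hd.torusGen ^ m) x
  rw [hfun, orbitalIntegral_indicator_complex_eq_ofReal, orbitalIntegral_doubleCosetShell_eq_mul_ncard_displaced hd γ t ν ht m hfin]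
  push_cast
  ring

end Unitary

/-! ## §2 The inert-place edition on `U(2,1)_w = U(J₀,3)(E_w)` -/

section Adic

open NumberField IsDedekindDomain Literature.NumberTheory.Automorphic.UnitaryGroup

variable {F E : Type} [Field F] [NumberField F] [Field E] [NumberField E] [Algebra F E] [Algebra.IsQuadraticExtension F E]
  (c : E ≃ₐ[F] E) (hc1 : c ≠ 1) (v : HeightOneSpectrum (𝓞 F)) (w : PlacesOver E v) (hw : c • w.1 = w.1)
  (hv : Algebra.IsUnramifiedIn (𝓞 E) v.asIdeal)
  [LocallyCompactSpace (unitaryGroupOfForm (galAdicCompletionMap (L := E) c hw) ((StdForm.antidiagonal 3).over (w.1.adicCompletion E)))]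
  [SecondCountableTopology (unitaryGroupOfForm (galAdicCompletionMap (L := E) c hw) ((StdForm.antidiagonal 3).over (w.1.adicCompletion E)))]
  [MeasurableSpace (unitaryGroupOfForm (galAdicCompletionMap (L := E) c hw) ((StdForm.antidiagonal 3).over (w.1.adicCompletion E)))]
  [BorelSpace (unitaryGroupOfForm (galAdicCompletionMap (L := E) c hw) ((StdForm.antidiagonal 3).over (w.1.adicCompletion E)))]
  (γ : unitaryGroupOfForm (galAdicCompletionMap (L := E) c hw) ((StdForm.antidiagonal 3).over (w.1.adicCompletion E)))
  [MeasurableSpace (unitaryGroupOfForm (galAdicCompletionMap (L := E) c hw) ((StdForm.antidiagonal 3).over (w.1.adicCompletion E)) ⧸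
    Subgroup.centralizer ({γ} : Set (unitaryGroupOfForm (galAdicCompletionMap (L := E) c hw) ((StdForm.antidiagonal 3).over (w.1.adicCompletion E)))))]
  [BorelSpace (unitaryGroupOfForm (galAdicCompletionMap (L := E) c hw) ((StdForm.antidiagonal 3).over (w.1.adicCompletion E)) ⧸
    Subgroup.centralizer ({γ} : Set (unitaryGroupOfForm (galAdicCompletionMap (L := E) c hw) ((StdForm.antidiagonal 3).over (w.1.adicCompletion E)))))]
  [hC : IsClosed ((Subgroup.centralizer ({γ} : Set (unitaryGroupOfForm (galAdicCompletionMap (L := E) c hw) ((StdForm.antidiagonal 3).over (w.1.adicCompletion E)))) :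
    Subgroup (unitaryGroupOfForm (galAdicCompletionMap (L := E) c hw) ((StdForm.antidiagonal 3).over (w.1.adicCompletion E)))) :
      Set (unitaryGroupOfForm (galAdicCompletionMap (L := E) c hw) ((StdForm.antidiagonal 3).over (w.1.adicCompletion E))))]
  (t : Measure (Subgroup.centralizer ({γ} : Set (unitaryGroupOfForm (galAdicCompletionMap (L := E) c hw) ((StdForm.antidiagonal 3).over (w.1.adicCompletion E))))))
  [t.IsMulLeftInvariant] [IsFiniteMeasureOnCompacts t] [t.IsOpenPosMeasure] [t.IsInvInvariant] [SFinite t]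
  (ν : Measure (unitaryGroupOfForm (galAdicCompletionMap (L := E) c hw) ((StdForm.antidiagonal 3).over (w.1.adicCompletion E))))
  [IsHaarMeasure ν] [ν.IsMulRightInvariant]
  [CompactSpace (Subgroup.centralizer ({γ} : Set (unitaryGroupOfForm (galAdicCompletionMap (L := E) c hw) ((StdForm.antidiagonal 3).over (w.1.adicCompletion E)))))]
  (ht : t Set.univ = 1)
include ht

/-- **CARD G3, INERT-PLACE EDITION**: at an inert unramified place `w ∣ v` of `E ∕ F`, for `f = Σ_{k ≤ m} c_k Φ_k ∈ ℋ(U(J₀,3)(E_w), K₀)` (`Φ_k = T_{K₀ t_wᵏ K₀}`,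
`t_w = hd_w.torusGen`, `hd_w = unramifiedLocalConjDatum_localConjUniformizer …`), `γ ∈ U(J₀,3)(E_w)` with COMPACT centraliser (mass-one `t`), `ν` Haar, finitely many
hyperspecial vertices of `X₃(E_w)` displaced by `2k` for each `k ≤ m`:  `O_γ^{ν∕t}(g ↦ (f [K₀])(gK₀)) = ν(K₀) · Σ_{k ≤ m} c_k · #{x ∈ X₃(E_w) : x self-dual ∧ d(x, γ·x) = 2k}`
(`K₀` compact ★ `isCompact_unitaryInt_adicCompletion`, Hecke pair ★ `isHeckeTriple_unitaryInt_adicCompletion`). [cite: Rogawski1990, §4.9 pp. 54–55] [cite: Kottwitz1986BaseChangeUnits, §1 pp. 240–242] -/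
theorem orbitalIntegral_coeff_toVector_eq_mul_sum_range_ncard_displaced_adic (m : ℕ) (b : ℕ → ℂ)
    (f : heckeAlgebra ℂ (unitaryGroupOfForm (galAdicCompletionMap (L := E) c hw) ((StdForm.antidiagonal 3).over (w.1.adicCompletion E)))
      (unitaryInt (galAdicCompletionMap (L := E) c hw) ((StdForm.antidiagonal 3).over (w.1.adicCompletion E))))
    (hf : haveI := isHeckeTriple_unitaryInt_adicCompletion c v w hw ((StdForm.antidiagonal 3).over (w.1.adicCompletion E))
      f = ∑ k ∈ Finset.range (m + 1), b k •
        doubleCosetOperator (unitaryInt (galAdicCompletionMap (L := E) c hw) ((StdForm.antidiagonal 3).over (w.1.adicCompletion E)))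
          ((unramifiedLocalConjDatum_localConjUniformizer c hc1 v w hw hv).torusGen ^ k))
    (hfin : ∀ k ≤ m, {x : {M : Submodule 𝒪[w.1.adicCompletion E] (Fin 3 → w.1.adicCompletion E) //
        IsVertex (galAdicCompletionMap (L := E) c hw) (localConjUniformizer c hc1 v w hw hv) ((StdForm.antidiagonal 3).over (w.1.adicCompletion E)) M} |
        IsSelfDualLattice (galAdicCompletionMap (L := E) c hw) (localConjUniformizer c hc1 v w hw hv) ((StdForm.antidiagonal 3).over (w.1.adicCompletion E)) x.1 ∧
          (latticeGraph (galAdicCompletionMap (L := E) c hw) (localConjUniformizer c hc1 v w hw hv) ((StdForm.antidiagonal 3).over (w.1.adicCompletion E))).dist x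
            (latticeGraphPerm (galAdicCompletionMap (L := E) c hw) (localConjUniformizer c hc1 v w hw hv)
              ((StdForm.antidiagonal 3).over (w.1.adicCompletion E)) γ x) = 2 * k}.Finite) :
    orbitalIntegral γ
        (fun x : unitaryGroupOfForm (galAdicCompletionMap (L := E) c hw) ((StdForm.antidiagonal 3).over (w.1.adicCompletion E)) =>
          (toVector (unitaryInt (galAdicCompletionMap (L := E) c hw) ((StdForm.antidiagonal 3).over (w.1.adicCompletion E))) f).coeff
            (x : unitaryGroupOfForm (galAdicCompletionMap (L := E) c hw) ((StdForm.antidiagonal 3).over (w.1.adicCompletion E)) ⧸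
              unitaryInt (galAdicCompletionMap (L := E) c hw) ((StdForm.antidiagonal 3).over (w.1.adicCompletion E))))
        (quotientMeasure (Subgroup.centralizer ({γ} : Set (unitaryGroupOfForm (galAdicCompletionMap (L := E) c hw)
          ((StdForm.antidiagonal 3).over (w.1.adicCompletion E))))) t hC ν) =
      (ν (unitaryInt (galAdicCompletionMap (L := E) c hw) ((StdForm.antidiagonal 3).over (w.1.adicCompletion E)))).toReal *
        ∑ k ∈ Finset.range (m + 1), b k *
          ({x : {M : Submodule 𝒪[w.1.adicCompletion E] (Fin 3 → w.1.adicCompletion E) //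
              IsVertex (galAdicCompletionMap (L := E) c hw) (localConjUniformizer c hc1 v w hw hv) ((StdForm.antidiagonal 3).over (w.1.adicCompletion E)) M} |
              IsSelfDualLattice (galAdicCompletionMap (L := E) c hw) (localConjUniformizer c hc1 v w hw hv) ((StdForm.antidiagonal 3).over (w.1.adicCompletion E)) x.1 ∧
                (latticeGraph (galAdicCompletionMap (L := E) c hw) (localConjUniformizer c hc1 v w hw hv) ((StdForm.antidiagonal 3).over (w.1.adicCompletion E))).dist x
                  (latticeGraphPerm (galAdicCompletionMap (L := E) c hw) (localConjUniformizer c hc1 v w hw hv)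
                    ((StdForm.antidiagonal 3).over (w.1.adicCompletion E)) γ x) = 2 * k}.ncard : ℂ) := by
  haveI := isHeckeTriple_unitaryInt_adicCompletion c v w hw ((StdForm.antidiagonal 3).over (w.1.adicCompletion E))
  have hνK : ν (unitaryInt (galAdicCompletionMap (L := E) c hw) ((StdForm.antidiagonal 3).over (w.1.adicCompletion E))) ≠ ∞ :=
    (isCompact_unitaryInt_adicCompletion c v w hw ((StdForm.antidiagonal 3).over (w.1.adicCompletion E))).measure_lt_top.ne
  exact orbitalIntegral_coeff_toVector_eq_mul_sum_range_ncard_displaced_three (unramifiedLocalConjDatum_localConjUniformizer c hc1 v w hw hv)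
    γ t ν ht hνK m b f hf hfin

end Adic

end Summit.HodgeConjecture.HodgeConjecture.R90.S6

end
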